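import Literature.AlgebraicGeometry.ModuliOfAbelianVarieties.SiegelFamilyHumbertRealMultiplication
import HarnessLib

/-!
# The lattice dictionary on Runge's standard model: `Λ_{π(τ)} = ᵗR · L_τ(O ⊕ O^∨)` and the principal
# polarisation as Elkies–Kumar's trace form `E_M = Tr(α₁β₂ − α₂β₁)`

Layer `Literature/AlgebraicGeometry/ModuliOfAbelianVarieties`, namespace
`Literature.AlgebraicGeometry.ModuliOfAbelianVarieties.SiegelModuli`; lane `lit-hodgefound` (Track 2 foundations
library, Layer A4), seat `lit-hodgefound-skel-4`, row **A4-64**, FILE 3. Sequel of FILE 1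
(`SiegelFamilyHumbertModularEmbedding`: `R = rungeMatrix k l = (σᵢ(ωⱼ))`, `π(τ) = modularEmbedding k l hΔ τ =
ᵗR diag(τ) R`) and FILE 2 (`SiegelFamilyHumbertRealMultiplication`: `regRep` = Runge's `A(x)`, `realEmb h i = σᵢ`,
`A(x)ᵗR = ᵗR diag(σ(x))`), on the tree's Siegel torus `X_Z = ℂ²/(Z, 1₂)ℤ⁴` (`prinPeriod Z (m, n) = Zm + n`,
`prinForm Z` with `E_Z(Φ(m,n), Φ(m′,n′)) = −ᵗ(m,n)J(m′,n′)`, row A4-56 `prinForm_apply_prinPeriod`) — consumed BY NAME.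

## Sources followed, verbatim

* N. D. Elkies, A. Kumar, *K3 surfaces and equations for Hilbert modular surfaces*, Algebra & Number Theory **8**
  (2014) 2297–2411 (held text `paper:arxiv-1209.3527`), §3: "let `σ₁, σ₂` be the two embeddings of `K` into `ℝ`.
  The `SL₂(ℝ)² ⋊ C₂`-orbit contains the `ℤ`-module `M = O_D ⊕ O_D^*` [`O_D^*` the inverse different], which is
  equipped with the alternating `ℤ`-valued form `E_M((α₁, β₁), (α₂, β₂)) = Tr(α₁β₂ − α₂β₁)`. […] Now, for
  `z = (z₁, z₂) ∈ ℍ²`, consider the embedding `L_z : K ⊕ K → V = ℂ²`, `(α, β) ↦ αz + β = (σ₁(α)z₁ + σ₁(β),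
  σ₂(α)z₂ + σ₂(β))`, which gives us a lattice `L_z(M)` in `V` and a principally polarized abelian surface
  `A⁺_z = V/L_z(M)` […] the subring `{(α, 0) ∈ M} = O_D` acts on `A⁺_z` by `ι(α) : (α, 0)·L_z(M) ↦ L_z((α, 0)·M)`,
  i.e., `(ζ₁, ζ₂) ↦ (σ₁(α)ζ₁, σ₂(α)ζ₂)`."
* B. Runge, *Endomorphism rings of abelian surfaces and projective models of their moduli spaces*, Tohoku Math. J.
  **51** (1999), §4 p. 290: "`R = (σᵢ(ωⱼ))` the Gram matrix of `F`. Then `ᵗRR` is the symmetric positive definite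
  rational matrix `ᵗRR = (Tr_{F/ℚ}(ωᵢωⱼ))ᵢⱼ` […] `π[R] = ᵗR (τ₁ 0; 0 τ₂) R`", i.e. the lattice of `A_{π[R]}` is
  `π[R]ℤ² + ℤ² = ᵗR(diag(τ)Rℤ² + ᵗR⁻¹ℤ²)`.

## Dictionary and contents (definitions with bodies and proved theorems; NO named fact, net debt 0)

* §1 **the dual matrix** `dualRungeMatrix k l = S = (√Δ)⁻¹·(−σ₂(ω) 1; σ₁(ω) −1)`: `transpose_rungeMatrix_mul_dualRungeMatrix`
  (`ᵗRS = 1`, i.e. `Tr(ωᵢωⱼ^∨) = δᵢⱼ`: the columns of `S` are the real embeddings of the TRACE-DUAL basis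
  `ω₁^∨ = (ω − l)/(2ω − l)`, `ω₂^∨ = 1/(2ω − l)` of `O^∨`), `dualRungeMatrix_eq_inv` (`S = ᵗR⁻¹`), the trace duality
  `rungeMatrix_mulVec_dotProduct_dualRungeMatrix_mulVec` (`ᵗ(Rm)(Sn) = m·n`, i.e. `Tr(αβ) = m·n`),
  `dualRungeMatrix_mulVec_traceForm_mulVec` (`O ⊆ O^∨` via the trace form `ᵗRR`), `rungeMatrix_mulVec_eq_realEmb`
  (`R(a, b) = (σ_s(a + bω))_s`), **`realEmb_sqrtDisc_mul_dualRungeMatrix_mulVec`** (`σ_s(2ω − l)·(Sn)_s =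
  σ_s((n₂ − ln₁) + n₁ω)`: `(2ω − l)O^∨ = O`, "the inverse different").
* §2 **the dictionary**: `latticeEmb τ a b = L_τ(a, b) = (a_sτ_s + b_s)_s`; **`prinPeriod_modularEmbedding`**:
  `Φ_{π(τ)}(m, n) = π(τ)m + n = ᵗR · L_τ(Rm, Sn)` — Runge's `A_{π[R]}` is Elkies–Kumar's `A_τ = ℂ²/L_τ(O ⊕ O^∨)` up to
  the coordinate change `ᵗR` of `ℂ²`; `range_prinPeriod_modularEmbedding_intCast` (the lattice as a set);
  `prinForm_apply_prinPeriod_eq_dotProduct` (`E_Z(Φ(m,n), Φ(m′,n′)) = m·n′ − n·m′` for every `Z`) and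
  **`prinForm_modularEmbedding_eq_trace`**: `E_{π(τ)} = ᵗ(Rm)(Sn′) − ᵗ(Rm′)(Sn) = Σ_s[σ_s(α)σ_s(β′) − σ_s(α′)σ_s(β)]` —
  the principal polarisation IS `E_M = Tr(αβ′ − α′β)`; `rungeMatrix_mul_transpose_regRep` / `dualRungeMatrix_mul_regRep`
  (`RᵗA(x) = diag(σ(x))R`, `SA(x) = diag(σ(x))S`: through the dictionary `ρ(x) = diag(ᵗA(x), A(x))` of FILE 2 is
  multiplication by `x` on `O ⊕ O^∨`, Elkies–Kumar's `ι(α)`).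

## Scope

Real-vector formulation only (`α ∈ O` enters through its coordinates `m` on `(1, ω)` and its real embeddings
`realEmb`; `β ∈ O^∨` through its coordinates `n` on `(ω₁^∨, ω₂^∨)` and the vector `Sn` — the fractional ideal `O^∨`
of `F = O ⊗ ℚ` is not introduced as a Mathlib object); the `SL₂(ℝ)² ⋊ C₂`-orbit statement, non-principal
`M = 𝔞 ⊕ 𝔟`, and the quotient by `SL₂(O_D ⊕ O_D^*)` (the Hilbert modular surface `Y₋(D)`) are not formalised.

## References

* [ElkiesKumar2014HilbertModularSurfaces] N. D. Elkies, A. Kumar, *K3 surfaces and equations for Hilbert modular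
  surfaces*, Algebra & Number Theory 8 (2014) 2297–2411, §3.
* [Runge1999EndomorphismRingsAbelianSurfaces] B. Runge, *Endomorphism rings of abelian surfaces and projective models
  of their moduli spaces*, Tohoku Math. J. 51 (1999) 283–303, §4 (p. 290).
* [Lange2023AbelianVarietiesComplex] H. Lange, *Abelian Varieties over the Complex Numbers*, Springer (2023), §3.1.1
  Prop. 3.1.1 and (3.1) (the Siegel torus and its symplectic basis).
-/

noncomputable section

open Matrix Complex Module Function Set
open scoped UpperHalfPlane

namespace Literature.AlgebraicGeometry.ModuliOfAbelianVarieties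

namespace SiegelModuli

open Literature.NumberTheory.Automorphic (siegelUpperHalfSpace)
open Literature.NumberTheory.ModularForms.SiegelUpperHalfSpace
open Literature.Geometry.Kaehler Literature.Geometry.Kaehler.ComplexTorus
open Literature.Analysis.Complex Literature.LinearAlgebra.Alternating
open Sum

/-! ## §1 The trace-dual basis: `S = ᵗR⁻¹`, whose columns are the real embeddings of `ω₁^∨ = (ω − l)/(2ω − l)`,
`ω₂^∨ = 1/(2ω − l)` — a `ℤ`-basis of the inverse different `O^∨ = (2ω − l)⁻¹O` -/

section Dual

variable (k l : ℤ)

/-- **The dual matrix `S = ᵗR⁻¹ = (1/√Δ)·(−σ₂(ω) 1; σ₁(ω) −1)`**: `S_{sj} = σ_s(ωⱼ^∨)` for the trace-dual basis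
`(ω₁^∨, ω₂^∨)` of `(ω₁, ω₂) = (1, ω)` (`Tr(ωᵢωⱼ^∨) = δᵢⱼ ⟺ ᵗR S = 1`), i.e. `ω₁^∨ = −ω'/√Δ = (ω − l)/(2ω − l)`,
`ω₂^∨ = 1/(2ω − l)`: a `ℤ`-basis of `O^∨ = O_D^*`, "the inverse different". [cite: ElkiesKumar2014HilbertModularSurfaces, §3] [cite: Runge1999EndomorphismRingsAbelianSurfaces, §4 p. 290] -/
def dualRungeMatrix : Matrix (Fin 2) (Fin 2) ℝ :=
  (Real.sqrt (quadDisc k l : ℝ))⁻¹ • !![-quadRoot k l 1, 1; quadRoot k l 0, -1]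

/-- `(√Δ)⁻¹·(σ₁(ω) − σ₂(ω)) = 1`. [folklore] -/
private theorem sqrt_inv_mul_sub (h : 0 < quadDisc k l) :
    (Real.sqrt (quadDisc k l : ℝ))⁻¹ * (quadRoot k l 0 - quadRoot k l 1) = 1 := by
  rw [quadRoot_sub]
  exact inv_mul_cancel₀ ((Real.sqrt_pos.2 (by exact_mod_cast h)).ne')

/-- **`ᵗR S = 1`** (`Tr(ωᵢ ωⱼ^∨) = Σ_s σ_s(ωᵢ)σ_s(ωⱼ^∨) = δᵢⱼ`). [cite: ElkiesKumar2014HilbertModularSurfaces, §3] -/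
theorem transpose_rungeMatrix_mul_dualRungeMatrix (h : 0 < quadDisc k l) :
    (rungeMatrix k l)ᵀ * dualRungeMatrix k l = 1 := by
  have hc := sqrt_inv_mul_sub k l h
  ext i j
  fin_cases i <;> fin_cases j <;>
    simp [rungeMatrix, dualRungeMatrix, Matrix.mul_apply, Fin.sum_univ_two]
  · linear_combination hc
  · ring
  · linear_combination hc

/-- `S ᵗR = 1`. [cite: ElkiesKumar2014HilbertModularSurfaces, §3] -/
theorem dualRungeMatrix_mul_transpose_rungeMatrix (h : 0 < quadDisc k l) :
    dualRungeMatrix k l * (rungeMatrix k l)ᵀ = 1 := by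
  have hc := sqrt_inv_mul_sub k l h
  ext i j
  fin_cases i <;> fin_cases j <;>
    simp [rungeMatrix, dualRungeMatrix, Matrix.mul_apply, Fin.sum_univ_two]
  · linear_combination hc
  · linear_combination hc

/-- **`S = (ᵗR)⁻¹`.** [cite: Runge1999EndomorphismRingsAbelianSurfaces, §4 p. 290] -/
theorem dualRungeMatrix_eq_inv (h : 0 < quadDisc k l) : dualRungeMatrix k l = ((rungeMatrix k l)ᵀ)⁻¹ :=
  (Matrix.inv_eq_right_inv (transpose_rungeMatrix_mul_dualRungeMatrix k l h)).symm

/-- `ᵗR(S n) = n`. [cite: ElkiesKumar2014HilbertModularSurfaces, §3] -/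
theorem transpose_rungeMatrix_mulVec_dualRungeMatrix_mulVec (h : 0 < quadDisc k l) (n : Fin 2 → ℝ) :
    (rungeMatrix k l)ᵀ *ᵥ (dualRungeMatrix k l *ᵥ n) = n := by
  rw [Matrix.mulVec_mulVec, transpose_rungeMatrix_mul_dualRungeMatrix k l h, Matrix.one_mulVec]

/-- `S(ᵗR u) = u`. [cite: ElkiesKumar2014HilbertModularSurfaces, §3] -/
theorem dualRungeMatrix_mulVec_transpose_rungeMatrix_mulVec (h : 0 < quadDisc k l) (u : Fin 2 → ℝ) :
    dualRungeMatrix k l *ᵥ ((rungeMatrix k l)ᵀ *ᵥ u) = u := by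
  rw [Matrix.mulVec_mulVec, dualRungeMatrix_mul_transpose_rungeMatrix k l h, Matrix.one_mulVec]

/-- **Trace duality `Tr(αβ) = m·n`**: for `α = m₁ + m₂ω` (real embeddings `Rm`) and `β = n₁ω₁^∨ + n₂ω₂^∨` (real
embeddings `Sn`), `Σ_s σ_s(α)σ_s(β) = ᵗ(Rm)(Sn) = m·n`. [cite: ElkiesKumar2014HilbertModularSurfaces, §3] -/
theorem rungeMatrix_mulVec_dotProduct_dualRungeMatrix_mulVec (h : 0 < quadDisc k l) (m n : Fin 2 → ℝ) :
    (rungeMatrix k l *ᵥ m) ⬝ᵥ (dualRungeMatrix k l *ᵥ n) = m ⬝ᵥ n := by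
  rw [← Matrix.vecMul_transpose, ← Matrix.dotProduct_mulVec,
    transpose_rungeMatrix_mulVec_dualRungeMatrix_mulVec k l h]

/-- **`O ⊆ O^∨` with the trace form as change of basis**: `α = m₁ + m₂ω` has dual coordinates `n = (Tr(ωᵢωⱼ))·m =
ᵗRR·m` (`S(ᵗRRm) = Rm`; `ᵗRR = (2 l; l l²+2k)` of determinant `Δ` — FILE 1 `transpose_rungeMatrix_mul_self`, FILE 2
`det_transpose_rungeMatrix_mul_self` — so `[O^∨ : O] = Δ`). [cite: Runge1999EndomorphismRingsAbelianSurfaces, §4 p. 290] [cite: ElkiesKumar2014HilbertModularSurfaces, §3] -/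
theorem dualRungeMatrix_mulVec_traceForm_mulVec (h : 0 < quadDisc k l) (m : Fin 2 → ℝ) :
    dualRungeMatrix k l *ᵥ (((rungeMatrix k l)ᵀ * rungeMatrix k l) *ᵥ m) = rungeMatrix k l *ᵥ m := by
  rw [← Matrix.mulVec_mulVec, dualRungeMatrix_mulVec_transpose_rungeMatrix_mulVec k l h]

variable {k l}

/-- **`Rm` is the vector of real embeddings of `α = m₁·1 + m₂·ω ∈ O`**: `(R(a, b))_s = a + bσ_s(ω) = σ_s(a + bω)`
(the rows of `R = (σᵢ(ωⱼ))` evaluate the basis). [cite: Runge1999EndomorphismRingsAbelianSurfaces, §4 p. 290] [cite: ElkiesKumar2014HilbertModularSurfaces, §3] -/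
theorem rungeMatrix_mulVec_eq_realEmb (h : 0 ≤ quadDisc k l) (x : QuadraticAlgebra ℤ k l) :
    (rungeMatrix k l *ᵥ ![(x.re : ℝ), (x.im : ℝ)]) = fun s ↦ realEmb h s x := by
  funext s
  rw [realEmb_apply]
  fin_cases s <;> simp [rungeMatrix, Matrix.mulVec, dotProduct, Fin.sum_univ_two] <;> ring

/-- **`O^∨ = (2ω − l)⁻¹O` ("the inverse different")**: multiplying the real embeddings `Sn` of
`β = n₁ω₁^∨ + n₂ω₂^∨` componentwise by `σ_s(2ω − l) = ±√Δ` gives the real embeddings of the element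
`(2ω − l)β = (n₂ − ln₁) + n₁ω ∈ O`. [cite: ElkiesKumar2014HilbertModularSurfaces, §3] -/
theorem realEmb_sqrtDisc_mul_dualRungeMatrix_mulVec (h : 0 < quadDisc k l) (n : Fin 2 → ℤ) (s : Fin 2) :
    realEmb h.le s (⟨-l, 2⟩ : QuadraticAlgebra ℤ k l) * (dualRungeMatrix k l *ᵥ fun j ↦ (n j : ℝ)) s =
      realEmb h.le s (⟨-l * n 0 + n 1, n 0⟩ : QuadraticAlgebra ℤ k l) := by
  have hc := sqrt_inv_mul_sub k l h
  have ha := quadRoot_add k l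
  rw [realEmb_apply, realEmb_apply]
  fin_cases s
  · simp [dualRungeMatrix, Matrix.mulVec, dotProduct, Fin.sum_univ_two]
    linear_combination ((n 1 : ℝ) - quadRoot k l 1 * n 0) * hc +
      ((Real.sqrt (quadDisc k l : ℝ))⁻¹ * ((n 1 : ℝ) - quadRoot k l 1 * n 0) - n 0) * ha
  · simp [dualRungeMatrix, Matrix.mulVec, dotProduct, Fin.sum_univ_two]
    linear_combination (-(quadRoot k l 0 * n 0 - (n 1 : ℝ))) * hc +
      ((Real.sqrt (quadDisc k l : ℝ))⁻¹ * (quadRoot k l 0 * n 0 - (n 1 : ℝ)) - n 0) * ha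

end Dual

/-! ## §2 The lattice dictionary `Λ_{π(τ)} = ᵗR · L_τ(O ⊕ O^∨)` and the polarisation `E = Tr(α₁β₂ − α₂β₁)` -/

section Lattice

variable (k l : ℤ)

/-- **Elkies–Kumar's `L_z` on real-embedding vectors**: `L_τ(a, b) = (a_s τ_s + b_s)_s ∈ ℂ²` — for `a = (σ_s(α))_s`,
`b = (σ_s(β))_s` this is "`(α, β) ↦ αz + β = (σ₁(α)z₁ + σ₁(β), σ₂(α)z₂ + σ₂(β))`".
[cite: ElkiesKumar2014HilbertModularSurfaces, §3] -/
def latticeEmb (τ : Fin 2 → ℂ) (a b : Fin 2 → ℝ) : Fin 2 → ℂ := fun s ↦ (a s : ℂ) * τ s + (b s : ℂ)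

/-- Unfolding of `latticeEmb`. [cite: ElkiesKumar2014HilbertModularSurfaces, §3] -/
theorem latticeEmb_apply (τ : Fin 2 → ℂ) (a b : Fin 2 → ℝ) (s : Fin 2) :
    latticeEmb τ a b s = (a s : ℂ) * τ s + (b s : ℂ) := rfl

variable {k l}

/-- **THE LATTICE DICTIONARY `Φ_{π(τ)}(m, n) = ᵗR · L_τ(Rm, Sn)`**: the period map of the Siegel torus
`X_{π(τ)} = ℂ²/(π(τ), 1₂)ℤ⁴`, `π(τ) = ᵗR diag(τ) R`, factors as `π(τ)m + n = ᵗR (diag(τ)Rm + Sn)`, `S = ᵗR⁻¹` — so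
`Λ_{π(τ)} = (π(τ), 1₂)ℤ⁴ = ᵗR · L_τ(O ⊕ O^∨)` with `m` the coordinates of `α ∈ O` on `(1, ω)` and `n` the coordinates of
`β ∈ O^∨` on the dual basis: Runge's `A_{π[R]}` IS Elkies–Kumar's `A_τ = ℂ²/L_τ(O_D ⊕ O_D^*)` up to the linear change of
coordinates `ᵗR` of `ℂ²`. [cite: ElkiesKumar2014HilbertModularSurfaces, §3] [cite: Runge1999EndomorphismRingsAbelianSurfaces, §4 p. 290] -/
theorem prinPeriod_modularEmbedding (hΔ : 0 < quadDisc k l) (τ : Fin 2 → ℍ) (v : Fin 2 ⊕ Fin 2 → ℝ) :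
    prinPeriod (modularEmbedding k l hΔ τ) v =
      ((rungeMatrix k l)ᵀ.map ((↑) : ℝ → ℂ)) *ᵥ
        latticeEmb (fun s ↦ (τ s : ℂ)) (rungeMatrix k l *ᵥ fun j ↦ v (inl j))
          (dualRungeMatrix k l *ᵥ fun j ↦ v (inr j)) := by
  obtain ⟨u, hu⟩ : ∃ u, dualRungeMatrix k l *ᵥ (fun j ↦ v (inr j)) = u := ⟨_, rfl⟩
  have key := transpose_rungeMatrix_mulVec_dualRungeMatrix_mulVec k l hΔ fun j ↦ v (inr j)
  rw [hu] at key
  have e0 := congrFun key 0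
  have e1 := congrFun key 1
  simp [rungeMatrix, Matrix.mulVec, dotProduct, Fin.sum_univ_two] at e0 e1
  have e0' : (v (inr 0) : ℂ) = (u 0 : ℂ) + (u 1 : ℂ) := by exact_mod_cast e0.symm
  have e1' : (v (inr 1) : ℂ) = (quadRoot k l 0 : ℂ) * (u 0 : ℂ) + (quadRoot k l 1 : ℂ) * (u 1 : ℂ) := by
    exact_mod_cast e1.symm
  rw [hu]
  funext i
  rw [prinPeriod_apply, coe_modularEmbedding, modularEmbeddingMatrix_eq]
  fin_cases i
  · simp [latticeEmb, rungeMatrix, Matrix.mulVec, dotProduct, Fin.sum_univ_two]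
    linear_combination e0'
  · simp [latticeEmb, rungeMatrix, Matrix.mulVec, dotProduct, Fin.sum_univ_two]
    linear_combination e1'

/-- **The lattice as a set: `Λ_{π(τ)} = ᵗR · {L_τ(σ(α), Sn) : α ∈ O, n ∈ ℤ²}`** — the image of `ℤ⁴` under `Φ_{π(τ)}` is
`ᵗR` applied to Elkies–Kumar's lattice `L_τ(O ⊕ O^∨)`, with `O ∋ α ↦ (σ_s(α))_s = realEmb` and `O^∨ = S·ℤ²`.
[cite: ElkiesKumar2014HilbertModularSurfaces, §3] -/
theorem range_prinPeriod_modularEmbedding_intCast (hΔ : 0 < quadDisc k l) (τ : Fin 2 → ℍ) :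
    Set.range (fun v : Fin 2 ⊕ Fin 2 → ℤ ↦ prinPeriod (modularEmbedding k l hΔ τ) fun a ↦ (v a : ℝ)) =
      {w | ∃ (x : QuadraticAlgebra ℤ k l) (n : Fin 2 → ℤ),
        w = ((rungeMatrix k l)ᵀ.map ((↑) : ℝ → ℂ)) *ᵥ
          latticeEmb (fun s ↦ (τ s : ℂ)) (fun s ↦ realEmb hΔ.le s x) (dualRungeMatrix k l *ᵥ fun j ↦ (n j : ℝ))} := by
  ext w
  simp only [Set.mem_range, Set.mem_setOf_eq]
  constructor
  · rintro ⟨v, rfl⟩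
    refine ⟨⟨v (inl 0), v (inl 1)⟩, fun j ↦ v (inr j), ?_⟩
    rw [prinPeriod_modularEmbedding, ← rungeMatrix_mulVec_eq_realEmb hΔ.le]
    congr 2
  · rintro ⟨x, n, rfl⟩
    refine ⟨Sum.elim ![x.re, x.im] n, ?_⟩
    rw [prinPeriod_modularEmbedding, ← rungeMatrix_mulVec_eq_realEmb hΔ.le]
    congr 2

/-- **The principal polarisation in lattice coordinates: `E_Z(Φ(m, n), Φ(m′, n′)) = m·n′ − n·m′`** (for every `Z`; the
symplectic basis `(Ze_i, e_i)`). [cite: Lange2023AbelianVarietiesComplex, §3.1.1 (3.1)] -/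
theorem prinForm_apply_prinPeriod_eq_dotProduct (Z : siegelUpperHalfSpace 2) (v w : Fin 2 ⊕ Fin 2 → ℝ) :
    prinForm Z ![prinPeriod Z v, prinPeriod Z w] =
      (fun j ↦ v (inl j)) ⬝ᵥ (fun j ↦ w (inr j)) - (fun j ↦ v (inr j)) ⬝ᵥ (fun j ↦ w (inl j)) := by
  rw [prinForm_apply_prinPeriod]
  simp [Matrix.J, dotProduct, Fintype.sum_sum_type, Fin.sum_univ_two, Matrix.mulVec]
  ring

/-- **THE POLARISATION IS ELKIES–KUMAR'S `E_M = Tr(α₁β₂ − α₂β₁)`**: on `X_{π(τ)}`, with `(m, n) ↔ (α, β) ∈ O ⊕ O^∨`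
as above, `E_{π(τ)}(Φ(m, n), Φ(m′, n′)) = ᵗ(Rm)(Sn′) − ᵗ(Rm′)(Sn) = Σ_s [σ_s(α)σ_s(β′) − σ_s(α′)σ_s(β)]`
("`M` is equipped with the alternating `ℤ`-valued form `E_M((α₁, β₁), (α₂, β₂)) = Tr(α₁β₂ − α₂β₁)`").
[cite: ElkiesKumar2014HilbertModularSurfaces, §3] -/
theorem prinForm_modularEmbedding_eq_trace (hΔ : 0 < quadDisc k l) (τ : Fin 2 → ℍ) (v w : Fin 2 ⊕ Fin 2 → ℝ) :
    prinForm (modularEmbedding k l hΔ τ)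
        ![prinPeriod (modularEmbedding k l hΔ τ) v, prinPeriod (modularEmbedding k l hΔ τ) w] =
      (rungeMatrix k l *ᵥ fun j ↦ v (inl j)) ⬝ᵥ (dualRungeMatrix k l *ᵥ fun j ↦ w (inr j)) -
        (rungeMatrix k l *ᵥ fun j ↦ w (inl j)) ⬝ᵥ (dualRungeMatrix k l *ᵥ fun j ↦ v (inr j)) := by
  rw [prinForm_apply_prinPeriod_eq_dotProduct, rungeMatrix_mulVec_dotProduct_dualRungeMatrix_mulVec k l hΔ,
    rungeMatrix_mulVec_dotProduct_dualRungeMatrix_mulVec k l hΔ, dotProduct_comm (fun j ↦ v (inr j))]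

/-- **Real multiplication in the dictionary: `ρ(x)` acts on `(m, n) ↔ (α, β)` as multiplication by `x` on
`O ⊕ O^∨`** — on the `α`-coordinates `m ↦ ᵗA(x)m` means `Rm ↦ diag(σ(x))·Rm` (`R ᵗA(x) = diag(σ(x)) R`, the transpose
of FILE 2's `A(x)ᵗR = ᵗR diag(σ(x))`): "the subring `O_D` acts by `ι(α) : (α, 0)·L_z(M) ↦ L_z((α, 0)·M)`".
[cite: ElkiesKumar2014HilbertModularSurfaces, §3] [cite: Runge1999EndomorphismRingsAbelianSurfaces, §4 p. 290] -/
theorem rungeMatrix_mul_transpose_regRep (h : 0 ≤ quadDisc k l) (x : QuadraticAlgebra ℤ k l) :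
    rungeMatrix k l * ((regRep k l x).map (Int.cast : ℤ → ℝ))ᵀ =
      Matrix.diagonal (fun i ↦ realEmb h i x) * rungeMatrix k l := by
  have hr := congrArg Matrix.transpose (regRep_mul_transpose_rungeMatrix h x)
  rw [Matrix.transpose_mul, Matrix.transpose_mul, Matrix.transpose_transpose, Matrix.diagonal_transpose] at hr
  exact hr

/-- … and on the `β`-coordinates `n ↦ A(x)n` means `Sn ↦ diag(σ(x))·Sn` (`S A(x) = diag(σ(x)) S`, from
`A(x)ᵗR = ᵗR diag(σ(x))` and `S = ᵗR⁻¹`): `O^∨` is an `O`-module and `β ↦ xβ` has real embeddings `σ_s(x)σ_s(β)`.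
[cite: ElkiesKumar2014HilbertModularSurfaces, §3] -/
theorem dualRungeMatrix_mul_regRep (h : 0 < quadDisc k l) (x : QuadraticAlgebra ℤ k l) :
    dualRungeMatrix k l * (regRep k l x).map (Int.cast : ℤ → ℝ) =
      Matrix.diagonal (fun i ↦ realEmb h.le i x) * dualRungeMatrix k l := by
  have hr := regRep_mul_transpose_rungeMatrix h.le x
  have hS := dualRungeMatrix_mul_transpose_rungeMatrix k l h
  have hS' := transpose_rungeMatrix_mul_dualRungeMatrix k l h
  calc dualRungeMatrix k l * (regRep k l x).map (Int.cast : ℤ → ℝ)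
      = dualRungeMatrix k l * (regRep k l x).map (Int.cast : ℤ → ℝ) * ((rungeMatrix k l)ᵀ * dualRungeMatrix k l) := by
        rw [hS', Matrix.mul_one]
    _ = dualRungeMatrix k l * ((regRep k l x).map (Int.cast : ℤ → ℝ) * (rungeMatrix k l)ᵀ) * dualRungeMatrix k l := by
        simp only [Matrix.mul_assoc]
    _ = dualRungeMatrix k l * (rungeMatrix k l)ᵀ * Matrix.diagonal (fun i ↦ realEmb h.le i x) *
          dualRungeMatrix k l := by
        rw [hr]; simp only [Matrix.mul_assoc]
    _ = Matrix.diagonal (fun i ↦ realEmb h.le i x) * dualRungeMatrix k l := by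
        rw [hS, Matrix.one_mul]

end Lattice

end SiegelModuli

end Literature.AlgebraicGeometry.ModuliOfAbelianVarieties
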